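import Summits.KontsevichZagierPeriods.KontsevichZagierPeriods.Theorems.TerasomaMultiplicationMultiplicationAccessibleCornerThetaDerivBoundGenAux

/-!
# `MultiplicationAccessible` (stmt-KontsevichZagierPeriods-12305), line `shifted-family-prime-sieve`:
slice calculus for the `θ_i`-derivative bound, all `p = n + 2` — the bracket, the Dirichlet factor and
the geometric mean (second auxiliary file)

Along the `θ_i`-slice of the chart domain: the bracket `B = Σ_j Θ_j (M_{i+1} − M_j)` satisfies
`|B| ≤ x y`, `|B| ≤ 2 t₀ t_{i+1}` and `|∂B| ≤ p (x y + 2 p x y)`; the Dirichlet factor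
`K = (∏Θ)^(s−1)` has `|∂K| ≤ p (s − 1)`; the geometric mean `Z` has the COMPENSATED derivative bound
`|∂Z| · t₀ t_{i+1} ≤ y² Z / p`. References: Kontsevich–Zagier 2001 §1.2 rule (3).
-/

noncomputable section

open MeasureTheory Set Real
open scoped BigOperators Topology
open Literature.NumberTheory.Transcendental
open Literature.NumberTheory.Transcendental.KZ

namespace Summit.KontsevichZagierPeriods.TerasomaMultiplication.MultiplicationAccessible

namespace CornerThetaDeriv

variable {n : ℕ}

/-- **The bracket `B = Σ_j Θ_j (M_{i+1} − M_j)`** on the chart domain: `|B| ≤ x·y`,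
`|B| ≤ 2 t₀ t_{i+1}`, and its slice derivative exists with `|∂B| ≤ p·(x y + 2 p x y)`. [folklore] -/
theorem B_facts {x : ℚ} (hx : 2 ≤ x) {Θ T M : (Fin (n + 2) → ℝ) → Fin (n + 2) → ℝ}
    (hΘ0 : ∀ u, Θ u 0 = 1 - ∑ i : Fin (n + 1), u (Fin.castSucc i))
    (hΘs : ∀ u (i : Fin (n + 1)), Θ u i.succ = u (Fin.castSucc i))
    (hT : ∀ u k, T u k = 1 - u (Fin.last (n + 1)) * Θ u k)
    (hM : ∀ u k, M u k = (T u k) ^ (x:ℝ) * ∏ j : Fin (n + 1), (T u (k + j.succ)) ^ ((x:ℝ) + (((j:ℕ):ℝ) + 1) / ((n:ℝ) + 2) - 1))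
    {u : Fin (n + 2) → ℝ}
    (hu : u ∈ {u : Fin (n + 2) → ℝ | (∀ i : Fin (n + 1), 0 < u (Fin.castSucc i)) ∧ ∑ i : Fin (n + 1), u (Fin.castSucc i) < 1 ∧ 0 < u (Fin.last (n + 1)) ∧ u (Fin.last (n + 1)) * (1 - ∑ i : Fin (n + 1), u (Fin.castSucc i)) < 1 ∧ ∀ i : Fin (n + 1), u (Fin.last (n + 1)) * u (Fin.castSucc i) < 1})
    (i : Fin (n + 1)) :
    |∑ j, Θ u j * (M u i.succ - M u j)| ≤ x * u (Fin.last (n + 1)) ∧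
      |∑ j, Θ u j * (M u i.succ - M u j)| ≤ 2 * (T u 0 * T u i.succ) ∧
      ∃ D, HasDerivAt (fun a => ∑ j, Θ (Function.update u (Fin.castSucc i) a) j *
          (M (Function.update u (Fin.castSucc i) a) i.succ - M (Function.update u (Fin.castSucc i) a) j))
          D (u (Fin.castSucc i)) ∧
        |D| ≤ ((n:ℝ) + 2) * (x * u (Fin.last (n + 1)) + 2 * (((n:ℝ) + 2) * (x * u (Fin.last (n + 1))))) := by
  set y := u (Fin.last (n + 1)) with hy
  have hMf := fun j => M_facts hx hΘ0 hΘs hT hM hu i j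
  have hΘm := fun l => (CornerGraphGen.T_mem hΘ0 hΘs hT hu l).1
  have hsum := CornerGraphGen.sum_theta hΘ0 hΘs u
  have hdiff : ∀ j, |M u i.succ - M u j| ≤ x * y := by
    intro j
    have h1 := (hMf j).2.2.1
    have h2 := (hMf i.succ).2.2.1
    have h3 := (hMf j).1.2
    have h4 := (hMf i.succ).1.2
    rw [abs_le]; constructor <;> linarith
  refine ⟨?_, ?_, ?_⟩
  · calc |∑ j, Θ u j * (M u i.succ - M u j)| ≤ ∑ j, |Θ u j * (M u i.succ - M u j)| :=
          Finset.abs_sum_le_sum_abs _ _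
      _ ≤ ∑ j, Θ u j * (x * y) := Finset.sum_le_sum fun j _ => by
          rw [abs_mul, abs_of_pos (hΘm j).1]
          exact mul_le_mul_of_nonneg_left (hdiff j) (hΘm j).1.le
      _ = x * y := by rw [← Finset.sum_mul, hsum, one_mul]
  · calc |∑ j, Θ u j * (M u i.succ - M u j)| ≤ ∑ j, |Θ u j * (M u i.succ - M u j)| :=
          Finset.abs_sum_le_sum_abs _ _
      _ ≤ ∑ j, Θ u j * (2 * (T u 0 * T u i.succ)) := Finset.sum_le_sum fun j _ => by
          rw [abs_mul, abs_of_pos (hΘm j).1]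
          refine mul_le_mul_of_nonneg_left ?_ (hΘm j).1.le
          have h1 := (hMf j).2.1
          have h2 := (hMf i.succ).2.1
          have h3 := (hMf j).1.1
          have h4 := (hMf i.succ).1.1
          rw [abs_le]; constructor <;> linarith
      _ = 2 * (T u 0 * T u i.succ) := by rw [← Finset.sum_mul, hsum, one_mul]
  · choose D hD hDb using fun j => (hMf j).2.2.2
    have hΘd := fun l => hasDerivAt_Theta hΘ0 hΘs u i (u (Fin.castSucc i)) l
    have hterm : ∀ j, HasDerivAt (fun a => Θ (Function.update u (Fin.castSucc i) a) j *
        (M (Function.update u (Fin.castSucc i) a) i.succ - M (Function.update u (Fin.castSucc i) a) j))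
        (Fin.cases (-1) (fun j' => if j' = i then 1 else 0) j * (M u i.succ - M u j) +
          Θ u j * (D i.succ - D j)) (u (Fin.castSucc i)) := by
      intro j
      have h := (hΘd j).fun_mul ((hD i.succ).fun_sub (hD j))
      simp only [Function.update_eq_self] at h
      exact h
    refine ⟨_, HasDerivAt.fun_sum fun j _ => hterm j, ?_⟩
    have hdΘ : ∀ j, |(Fin.cases (-1) (fun j' => if j' = i then 1 else 0) j : ℝ)| ≤ 1 := by
      intro j
      refine Fin.cases ?_ (fun j' => ?_) j
      · simp
      · by_cases h : j' = i <;> simp [h]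
    have hxy : 0 ≤ x * y := by
      have hx' : (2:ℝ) ≤ x := by exact_mod_cast hx
      have : 0 < y := hu.2.2.1
      positivity
    calc |∑ j, (Fin.cases (-1) (fun j' => if j' = i then 1 else 0) j * (M u i.succ - M u j) +
          Θ u j * (D i.succ - D j))|
        ≤ ∑ j, |Fin.cases (-1) (fun j' => if j' = i then 1 else 0) j * (M u i.succ - M u j) +
          Θ u j * (D i.succ - D j)| := Finset.abs_sum_le_sum_abs _ _
      _ ≤ ∑ _j : Fin (n + 2), (x * y + 2 * (((n:ℝ) + 2) * (x * y))) := Finset.sum_le_sum fun j _ => by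
          calc |Fin.cases (-1) (fun j' => if j' = i then 1 else 0) j * (M u i.succ - M u j) +
                Θ u j * (D i.succ - D j)|
              ≤ |Fin.cases (-1) (fun j' => if j' = i then 1 else 0) j * (M u i.succ - M u j)| +
                |Θ u j * (D i.succ - D j)| := abs_add_le _ _
            _ ≤ 1 * (x * y) + 1 * (((n:ℝ) + 2) * (x * y) + ((n:ℝ) + 2) * (x * y)) := by
                rw [abs_mul, abs_mul, abs_of_pos (hΘm j).1]
                have hΘ1 : Θ u j ≤ 1 :=
                  ((basic hΘ0 hΘs hT (Z := fun u => (∏ k, T u k) ^ (1 / ((n:ℝ) + 2))) (fun _ => rfl) hu).2.1 j).2.le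
                have hD2 : |D i.succ - D j| ≤ ((n:ℝ) + 2) * (x * y) + ((n:ℝ) + 2) * (x * y) :=
                  (abs_sub _ _).trans (add_le_add (hDb _) (hDb _))
                exact add_le_add (mul_le_mul (hdΘ j) (hdiff j) (abs_nonneg _) zero_le_one)
                  (mul_le_mul hΘ1 hD2 (abs_nonneg _) zero_le_one)
            _ = x * y + 2 * (((n:ℝ) + 2) * (x * y)) := by ring
      _ = ((n:ℝ) + 2) * (x * y + 2 * (((n:ℝ) + 2) * (x * y))) := by
          rw [Finset.sum_const, Finset.card_univ, Fintype.card_fin, nsmul_eq_mul]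
          push_cast
          ring

/-- **The Dirichlet factor `K = (∏Θ)^(s−1)`** on the chart domain (`s ≥ 3`): `K ∈ (0, 1]` and its
slice derivative exists with `|∂K| ≤ p (s − 1)`. [folklore] -/
theorem K_facts {s : ℚ} (hs : 3 ≤ s) {Θ T : (Fin (n + 2) → ℝ) → Fin (n + 2) → ℝ} {K : (Fin (n + 2) → ℝ) → ℝ}
    (hΘ0 : ∀ u, Θ u 0 = 1 - ∑ i : Fin (n + 1), u (Fin.castSucc i))
    (hΘs : ∀ u (i : Fin (n + 1)), Θ u i.succ = u (Fin.castSucc i))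
    (hT : ∀ u k, T u k = 1 - u (Fin.last (n + 1)) * Θ u k)
    (hK : ∀ u, K u = (∏ k, Θ u k) ^ ((s:ℝ) - 1)) {u : Fin (n + 2) → ℝ}
    (hu : u ∈ {u : Fin (n + 2) → ℝ | (∀ i : Fin (n + 1), 0 < u (Fin.castSucc i)) ∧ ∑ i : Fin (n + 1), u (Fin.castSucc i) < 1 ∧ 0 < u (Fin.last (n + 1)) ∧ u (Fin.last (n + 1)) * (1 - ∑ i : Fin (n + 1), u (Fin.castSucc i)) < 1 ∧ ∀ i : Fin (n + 1), u (Fin.last (n + 1)) * u (Fin.castSucc i) < 1})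
    (i : Fin (n + 1)) :
    (0 < K u ∧ K u ≤ 1) ∧
      ∃ D, HasDerivAt (fun a => K (Function.update u (Fin.castSucc i) a)) D (u (Fin.castSucc i)) ∧
        |D| ≤ ((n:ℝ) + 2) * ((s:ℝ) - 1) := by
  have hs' : (3:ℝ) ≤ s := by exact_mod_cast hs
  have hΘb := (basic hΘ0 hΘs hT (Z := fun u => (∏ k, T u k) ^ (1 / ((n:ℝ) + 2))) (fun _ => rfl) hu).2.1
  have hP0 : 0 < ∏ k, Θ u k := Finset.prod_pos fun k _ => (hΘb k).1
  have hP1 : ∏ k, Θ u k ≤ 1 := Finset.prod_le_one (fun k _ => (hΘb k).1.le) fun k _ => (hΘb k).2.le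
  have hs1 : (0:ℝ) ≤ (s:ℝ) - 1 := by linarith
  have hK0 : 0 < K u := by rw [hK]; exact rpow_pos_of_pos hP0 _
  have hK1 : K u ≤ 1 := by rw [hK]; exact rpow_le_one hP0.le hP1 hs1
  refine ⟨⟨hK0, hK1⟩, ?_⟩
  have hΘd := fun l => hasDerivAt_Theta hΘ0 hΘs u i (u (Fin.castSucc i)) l
  obtain ⟨D, hD, hDb⟩ := exists_hasDerivAt_prod_le Finset.univ
    (fun l a => Θ (Function.update u (Fin.castSucc i) a) l) _ (u (Fin.castSucc i)) 1
    (fun l _ => hΘd l) (fun l _ => by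
      simp only [Function.update_eq_self]; exact ⟨(hΘb l).1.le, (hΘb l).2.le⟩)
    (fun l _ => by
      refine Fin.cases ?_ (fun j' => ?_) l
      · simp
      · by_cases h : j' = i <;> simp [h])
  have hK' := hD.rpow_const (p := (s:ℝ) - 1) (Or.inl (by
    simp only [Function.update_eq_self]; exact hP0.ne'))
  simp only [Function.update_eq_self] at hK'
  refine ⟨_, hK'.congr_of_eventuallyEq (Filter.Eventually.of_forall fun a => by simp only [hK]), ?_⟩
  rw [Finset.card_univ, Fintype.card_fin, mul_one] at hDb
  have hq0 : 0 ≤ (∏ k, Θ u k) ^ ((s:ℝ) - 1 - 1) := rpow_nonneg hP0.le _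
  have hq1 : (∏ k, Θ u k) ^ ((s:ℝ) - 1 - 1) ≤ 1 := rpow_le_one hP0.le hP1 (by linarith)
  rw [abs_mul, abs_mul, abs_of_nonneg (by linarith : (0:ℝ) ≤ (s:ℝ) - 1), abs_of_nonneg hq0]
  push_cast at hDb
  calc |D| * ((s:ℝ) - 1) * (∏ k, Θ u k) ^ ((s:ℝ) - 1 - 1) ≤ ((n:ℝ) + 2) * ((s:ℝ) - 1) * 1 :=
        mul_le_mul (mul_le_mul_of_nonneg_right hDb hs1) hq1 hq0 (by positivity)
    _ = ((n:ℝ) + 2) * ((s:ℝ) - 1) := mul_one _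

/-- **The geometric mean `Z = (∏t)^(1/p)` along the slice**: its derivative `Z'` exists and satisfies
the compensated bound `|Z'| · t₀ t_{i+1} ≤ y² Z / p` (only `t₀`, `t_{i+1}` move, with speed `±y`,
and `|t_{i+1} − t₀| ≤ y`). [folklore] -/
theorem Z_facts {Θ T : (Fin (n + 2) → ℝ) → Fin (n + 2) → ℝ} {Z : (Fin (n + 2) → ℝ) → ℝ}
    (hΘ0 : ∀ u, Θ u 0 = 1 - ∑ i : Fin (n + 1), u (Fin.castSucc i))
    (hΘs : ∀ u (i : Fin (n + 1)), Θ u i.succ = u (Fin.castSucc i))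
    (hT : ∀ u k, T u k = 1 - u (Fin.last (n + 1)) * Θ u k)
    (hZ : ∀ u, Z u = (∏ k, T u k) ^ (1 / ((n:ℝ) + 2))) {u : Fin (n + 2) → ℝ}
    (hu : u ∈ {u : Fin (n + 2) → ℝ | (∀ i : Fin (n + 1), 0 < u (Fin.castSucc i)) ∧ ∑ i : Fin (n + 1), u (Fin.castSucc i) < 1 ∧ 0 < u (Fin.last (n + 1)) ∧ u (Fin.last (n + 1)) * (1 - ∑ i : Fin (n + 1), u (Fin.castSucc i)) < 1 ∧ ∀ i : Fin (n + 1), u (Fin.last (n + 1)) * u (Fin.castSucc i) < 1})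
    (i : Fin (n + 1)) :
    ∃ Z', HasDerivAt (fun a => Z (Function.update u (Fin.castSucc i) a)) Z' (u (Fin.castSucc i)) ∧
      |Z'| * (T u 0 * T u i.succ) ≤ u (Fin.last (n + 1)) ^ 2 * Z u / ((n:ℝ) + 2) := by
  set y := u (Fin.last (n + 1)) with hy
  obtain ⟨⟨hy0, -⟩, hΘb, hTb, ⟨hZ0, -⟩, -⟩ := basic hΘ0 hΘs hT hZ hu
  set R := ∏ l ∈ (Finset.univ.erase 0).erase i.succ, T u l with hR
  obtain ⟨hR0, hR1⟩ := R_mem hΘ0 hΘs hT hu i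
  have hp : (0:ℝ) < (n:ℝ) + 2 := by positivity
  -- the two moving box coordinates
  have d0 := hasDerivAt_T hΘ0 hΘs hT u i (u (Fin.castSucc i)) 0
  have di := hasDerivAt_T hΘ0 hΘs hT u i (u (Fin.castSucc i)) i.succ
  simp only [Fin.cases_zero, Fin.cases_succ, if_true, mul_neg, mul_one, neg_neg] at d0 di
  have hPi : HasDerivAt (fun a => ∏ l, T (Function.update u (Fin.castSucc i) a) l)
      ((y * T u i.succ + T u 0 * (-y)) * R) (u (Fin.castSucc i)) := by
    have h := ((d0.mul di).mul_const R)
    simp only [Function.update_eq_self] at h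
    refine h.congr_of_eventuallyEq (Filter.Eventually.of_forall fun a => ?_)
    exact prod_T_update hΘs hT u i a
  have hPi0 : 0 < ∏ l, T u l := Finset.prod_pos fun l _ => (hTb l).1
  have hPieq : ∏ l, T u l = T u 0 * T u i.succ * R := by
    have := prod_T_update hΘs hT u i (u (Fin.castSucc i))
    simp only [Function.update_eq_self] at this
    exact this
  have hZd := hPi.rpow_const (p := 1 / ((n:ℝ) + 2)) (Or.inl (by
    simp only [Function.update_eq_self]; exact hPi0.ne'))
  simp only [Function.update_eq_self] at hZd
  refine ⟨_, hZd.congr_of_eventuallyEq (Filter.Eventually.of_forall fun a => by simp only [hZ]), ?_⟩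
  -- the compensated bound
  have hpow : (∏ l, T u l) ^ (1 / ((n:ℝ) + 2) - 1) = Z u / ∏ l, T u l := by
    rw [rpow_sub_one hPi0.ne', hZ]
  have hdiff : |T u i.succ - T u 0| ≤ y := by
    rw [hT, hT]
    have h1 := hΘb 0
    have h2 := hΘb i.succ
    rw [abs_le]; constructor <;> nlinarith
  have hkey : |(y * T u i.succ + T u 0 * (-y)) * R| = y * R * |T u i.succ - T u 0| := by
    rw [show (y * T u i.succ + T u 0 * (-y)) * R = (y * R) * (T u i.succ - T u 0) by ring, abs_mul,
      abs_of_pos (mul_pos hy0 hR0)]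
  rw [abs_mul, abs_mul, hkey, hpow, abs_of_pos (one_div_pos.mpr hp), abs_of_pos (div_pos hZ0 hPi0), hPieq]
  have hT0 := (hTb 0).1
  have hTi := (hTb i.succ).1
  have hTTR : T u 0 * T u i.succ * R ≠ 0 := (mul_pos (mul_pos hT0 hTi) hR0).ne'
  calc y * R * |T u i.succ - T u 0| * (1 / ((n:ℝ) + 2)) * (Z u / (T u 0 * T u i.succ * R)) * (T u 0 * T u i.succ)
      = y * |T u i.succ - T u 0| * Z u / ((n:ℝ) + 2) * ((T u 0 * T u i.succ * R) / (T u 0 * T u i.succ * R)) := by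
        ring
    _ = y * |T u i.succ - T u 0| * Z u / ((n:ℝ) + 2) := by rw [div_self hTTR, mul_one]
    _ ≤ y * y * Z u / ((n:ℝ) + 2) := by
        gcongr
    _ = y ^ 2 * Z u / ((n:ℝ) + 2) := by ring

end CornerThetaDeriv

/-- **Registered helper sub-goal `cornerThetaDerivSliceGen`** (serves `cornerThetaDerivBoundGen`): on the
chart domain, the bracket `B`, the Dirichlet factor `K` and the geometric mean `Z` have `θ_i`-slice
derivatives with the bounds `|B| ≤ x y`, `|B| ≤ 2 t₀ t_{i+1}`, `|∂B| ≤ p (x y + 2 p x y)`, `K ∈ (0,1]`,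
`|∂K| ≤ p (s − 1)`, `|∂Z| · t₀ t_{i+1} ≤ y² Z / p` (`x ≥ 2`, `s ≥ 3`). [folklore] -/
theorem cornerThetaDerivSliceGen : ∀ (n : ℕ) (x s : ℚ), 2 ≤ x → 3 ≤ s → ∀ (Θ T M : (Fin (n + 2) → ℝ) → Fin (n + 2) → ℝ) (Z K : (Fin (n + 2) → ℝ) → ℝ),
    (∀ u, Θ u 0 = 1 - ∑ i : Fin (n + 1), u (Fin.castSucc i)) → (∀ u (i : Fin (n + 1)), Θ u i.succ = u (Fin.castSucc i)) →
    (∀ u k, T u k = 1 - u (Fin.last (n + 1)) * Θ u k) →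
    (∀ u, Z u = (∏ k, T u k) ^ (1 / ((n:ℝ) + 2))) →
    (∀ u, K u = (∏ k, Θ u k) ^ ((s:ℝ) - 1)) →
    (∀ u k, M u k = (T u k) ^ (x:ℝ) * ∏ j : Fin (n + 1), (T u (k + j.succ)) ^ ((x:ℝ) + (((j:ℕ):ℝ) + 1) / ((n:ℝ) + 2) - 1)) →
    ∀ u ∈ {u : Fin (n + 2) → ℝ | (∀ i : Fin (n + 1), 0 < u (Fin.castSucc i)) ∧ ∑ i : Fin (n + 1), u (Fin.castSucc i) < 1 ∧ 0 < u (Fin.last (n + 1)) ∧ u (Fin.last (n + 1)) * (1 - ∑ i : Fin (n + 1), u (Fin.castSucc i)) < 1 ∧ ∀ i : Fin (n + 1), u (Fin.last (n + 1)) * u (Fin.castSucc i) < 1},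
    ∀ (i : Fin (n + 1)),
    (|∑ j, Θ u j * (M u i.succ - M u j)| ≤ x * u (Fin.last (n + 1)) ∧
      |∑ j, Θ u j * (M u i.succ - M u j)| ≤ 2 * (T u 0 * T u i.succ) ∧
      ∃ D, HasDerivAt (fun a => ∑ j, Θ (Function.update u (Fin.castSucc i) a) j *
          (M (Function.update u (Fin.castSucc i) a) i.succ - M (Function.update u (Fin.castSucc i) a) j))
          D (u (Fin.castSucc i)) ∧
        |D| ≤ ((n:ℝ) + 2) * (x * u (Fin.last (n + 1)) + 2 * (((n:ℝ) + 2) * (x * u (Fin.last (n + 1)))))) ∧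
    ((0 < K u ∧ K u ≤ 1) ∧
      ∃ D, HasDerivAt (fun a => K (Function.update u (Fin.castSucc i) a)) D (u (Fin.castSucc i)) ∧
        |D| ≤ ((n:ℝ) + 2) * ((s:ℝ) - 1)) ∧
    (∃ Z', HasDerivAt (fun a => Z (Function.update u (Fin.castSucc i) a)) Z' (u (Fin.castSucc i)) ∧
      |Z'| * (T u 0 * T u i.succ) ≤ u (Fin.last (n + 1)) ^ 2 * Z u / ((n:ℝ) + 2)) :=
  fun _ _ _ hx hs _ _ _ _ _ hΘ0 hΘs hT hZ hK hM _ hu i =>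
    ⟨CornerThetaDeriv.B_facts hx hΘ0 hΘs hT hM hu i, CornerThetaDeriv.K_facts hs hΘ0 hΘs hT hK hu i,
      CornerThetaDeriv.Z_facts hΘ0 hΘs hT hZ hu i⟩

end Summit.KontsevichZagierPeriods.TerasomaMultiplication.MultiplicationAccessible

end
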